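/-
Copyright (c) 2026. All rights reserved.
Released under Apache 2.0 license as described in the file LICENSE.
-/
import Summits.HubbardSuperconductivity.HubbardLadder.Bounds.SectorTwistRatioAssembled
import HarnessLib

/-!
# Theorem 13_N in closed elementary form (bounds.tex §13, D5(d′))

HONEST FRAMING: ladder R1–R4 with certified numbers; no claim on H/H₀. These are bounds for
MODEL CLASSES (the typed REPULSIVE `t–t'` Hubbard torus with a flux twist), no materials claim.

The assembled Theorem 13_N (#211.23 `norm_ttSectorZ_twist_sub_le_assembled`) still contains the
transfer walk constant `C₀ = transferWalkConstant n N K_w (β n r♯) 0` and the cardinalities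
`|Λ_L|`, `|Orb Λ_L|`. This part makes the bound a CLOSED ELEMENTARY EXPRESSION in
`(β, t', U, a, δ, F, c₀, u₀, r, N, K_w, L)`:

* `transferWalkConstant_zero_le_exp`:
  `C₀ ≤ exp((b + 2K_w - 1)(1/(N - K_w + 1) + 1/(n - N - K_w + 1)))` (`log(1 + x) ≤ x` on the
  two rational factors `(N + K_w)/(N - K_w + 1)`, `(n - N + K_w)/(n - N - K_w + 1)` of `C₀`);
* `|Λ_L| = L²`, `|Orb Λ_L| = 2L²`.

RESULT (`norm_ttSectorZ_twist_sub_le_elementary`): under exactly the numeric hypotheses of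
#211.23, `‖Z_N(θ) - Z_N(0)‖ ≤ (4/3)(4L√(1 + 4a/r²)·… + 1)·exp(2K_w (2βL²r♯ + 2K_w - 1)(1/(N - K_w
+ 1) + 1/(2L² - N - K_w + 1)))·((e^{2aL²e^{-δL}} - 1) + 2e^{-ηL²})·Re Z_N(0)` with
`η = e^{κ₋} + κ₋ - F - a`, `κ₋ = offArcRateFloor c₀ u₀ (N/L²) (2a/r)`, `r♯ = 4 + 4|t'| + |U|`
(the square root is kept as `√((1 + 4a/r²) L²)`). READING (stated, not hidden): with `K_w ≈
8L√(1+4a/r²)` and `N = ρ'·2L²` the walk exponent is `≈ 16√(1+4a/r²)·βr♯(1/ρ' + 1/(1-ρ'))·L +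
128(1+4a/r²)(1/ρ' + 1/(1-ρ'))`, against the numerator's `2aL²e^{-δL}`: the bound decays in `L`
iff `δ > 16√(1+4a/r²) βr♯ (1/ρ' + 1/(1-ρ'))` — a HIGH-TEMPERATURE condition (`δ(β)` may grow
like `½ log(a/(16βR²))` under the Kotecký–Preiss smallness while the right side is `∝ β`), and
then only for `L ≥ L₀` with `L₀` set by the `L`-independent term. NO instance row is certified
here (zero kit; successor work). No numerics, no `native_decide`; standard axioms only.
References: R. Kotecký, D. Preiss, Comm. Math. Phys. 103 (1986) 491 [KoteckyPreiss1986];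
D. Ueltschi, Analyticity in Hubbard models, J. Stat. Phys. 95 (1999) 693, §2.3 Prop. 2.2
[Ueltschi1999]; bounds.tex §13.
-/

noncomputable section

namespace Summit.HubbardSuperconductivity.HubbardLadder.Bounds

open Matrix Finset Complex
open Literature.MathematicalPhysics.QuantumLattice
open scoped ComplexOrder

/-! ### The walk constant in elementary form -/

/-- **`C₀ ≤ exp((b + 2K_w - 1)(1/(N - K_w + 1) + 1/(n - N - K_w + 1)))`** for `1 ≤ K_w ≤ N`,
`N + K_w ≤ n`: `C₀ = (1 + m/A)(1 + m/B) e^{b/A + b/B}` with `m = 2K_w - 1`, `A = N - K_w + 1`,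
`B = n - N - K_w + 1`, and `1 + x ≤ e^{x}`. [this file] -/
theorem transferWalkConstant_zero_le_exp {n N Kw : ℕ} (hKw : 1 ≤ Kw) (hKwN : Kw ≤ N)
    (hNKw : N + Kw ≤ n) (b : ℝ) :
    transferWalkConstant n N Kw b 0 ≤
      Real.exp ((b + (2 * Kw - 1)) * (1 / ((N : ℝ) - Kw + 1) + 1 / ((n : ℝ) - N - Kw + 1))) := by
  have hk1 : ((N - Kw : ℕ) : ℝ) = (N : ℝ) - Kw := by rw [Nat.cast_sub hKwN]
  have hk2 : ((N + Kw - 1 : ℕ) : ℝ) = (N : ℝ) + Kw - 1 := by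
    rw [Nat.cast_sub (by omega), Nat.cast_add, Nat.cast_one]
  have hKw1 : (1 : ℝ) ≤ Kw := by exact_mod_cast hKw
  have hKN : (Kw : ℝ) ≤ N := by exact_mod_cast hKwN
  have hNn : (N : ℝ) + Kw ≤ n := by exact_mod_cast hNKw
  have hA : (0 : ℝ) < (N : ℝ) - Kw + 1 := by linarith
  have hB : (0 : ℝ) < (n : ℝ) - N - Kw + 1 := by linarith
  have hm : (0 : ℝ) ≤ 2 * Kw - 1 := by linarith
  -- `C₀` as a product
  have key : transferWalkConstant n N Kw b 0 =
      (1 + (2 * Kw - 1) / ((N : ℝ) - Kw + 1)) * (1 + (2 * Kw - 1) / ((n : ℝ) - N - Kw + 1)) *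
        (Real.exp (b / ((N : ℝ) - Kw + 1)) * Real.exp (b / ((n : ℝ) - N - Kw + 1))) := by
    unfold transferWalkConstant transferAp transferAm
    rw [hk1, hk2, Real.exp_zero, Real.exp_neg]
    have h1 : (n : ℝ) - ((N : ℝ) + Kw - 1) = (n : ℝ) - N - Kw + 1 := by ring
    have h3 : (N : ℝ) + Kw - 1 + 1 = (N : ℝ) + Kw := by ring
    simp only [h1, h3]
    have hA' : (N : ℝ) - Kw + 1 ≠ 0 := hA.ne'
    have hB' : (n : ℝ) - N - Kw + 1 ≠ 0 := hB.ne'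
    have hS : (N : ℝ) + Kw ≠ 0 := by
      have : (0 : ℝ) < (N : ℝ) + Kw := by linarith
      exact this.ne'
    field_simp
    ring
  rw [key]
  have e1 : 1 + (2 * Kw - 1) / ((N : ℝ) - Kw + 1) ≤
      Real.exp ((2 * Kw - 1) / ((N : ℝ) - Kw + 1)) := by
    linarith [Real.add_one_le_exp ((2 * Kw - 1) / ((N : ℝ) - Kw + 1))]
  have e2 : 1 + (2 * Kw - 1) / ((n : ℝ) - N - Kw + 1) ≤
      Real.exp ((2 * Kw - 1) / ((n : ℝ) - N - Kw + 1)) := by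
    linarith [Real.add_one_le_exp ((2 * Kw - 1) / ((n : ℝ) - N - Kw + 1))]
  have p2 : 0 ≤ 1 + (2 * Kw - 1) / ((n : ℝ) - N - Kw + 1) := by
    have := div_nonneg hm hB.le
    linarith
  calc (1 + (2 * Kw - 1) / ((N : ℝ) - Kw + 1)) * (1 + (2 * Kw - 1) / ((n : ℝ) - N - Kw + 1)) *
        (Real.exp (b / ((N : ℝ) - Kw + 1)) * Real.exp (b / ((n : ℝ) - N - Kw + 1)))
      ≤ Real.exp ((2 * Kw - 1) / ((N : ℝ) - Kw + 1)) *
          Real.exp ((2 * Kw - 1) / ((n : ℝ) - N - Kw + 1)) *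
        (Real.exp (b / ((N : ℝ) - Kw + 1)) * Real.exp (b / ((n : ℝ) - N - Kw + 1))) :=
        mul_le_mul_of_nonneg_right (mul_le_mul e1 e2 p2 (Real.exp_pos _).le) (by positivity)
    _ = Real.exp ((b + (2 * Kw - 1)) * (1 / ((N : ℝ) - Kw + 1) + 1 / ((n : ℝ) - N - Kw + 1))) := by
        rw [← Real.exp_add, ← Real.exp_add, ← Real.exp_add]
        congr 1
        field_simp
        ring

/-- **`C₀^{2K_w} ≤ exp(2K_w (b + 2K_w - 1)(1/(N - K_w + 1) + 1/(n - N - K_w + 1)))`.**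
[this file] -/
theorem transferWalkConstant_zero_pow_le_exp {n N Kw : ℕ} (hKw : 1 ≤ Kw) (hKwN : Kw ≤ N)
    (hNKw : N + Kw ≤ n) (b : ℝ) :
    transferWalkConstant n N Kw b 0 ^ (2 * Kw) ≤
      Real.exp (2 * Kw * ((b + (2 * Kw - 1)) *
        (1 / ((N : ℝ) - Kw + 1) + 1 / ((n : ℝ) - N - Kw + 1)))) := by
  have h0 : 0 ≤ transferWalkConstant n N Kw b 0 :=
    (transferWalkConstant_pos (n := n) b 0 hKw hNKw).le
  calc transferWalkConstant n N Kw b 0 ^ (2 * Kw)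
      ≤ Real.exp ((b + (2 * Kw - 1)) *
          (1 / ((N : ℝ) - Kw + 1) + 1 / ((n : ℝ) - N - Kw + 1))) ^ (2 * Kw) :=
        pow_le_pow_left₀ h0 (transferWalkConstant_zero_le_exp hKw hKwN hNKw b) _
    _ = Real.exp (2 * Kw * ((b + (2 * Kw - 1)) *
          (1 / ((N : ℝ) - Kw + 1) + 1 / ((n : ℝ) - N - Kw + 1)))) := by
        rw [← Real.exp_nat_mul]; push_cast; ring_nf

/-! ### Theorem 13_N in closed form -/

section Torus

variable {L : ℕ} [NeZero L]

omit [NeZero L] in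
/-- `|Λ_L| = L²` (file-private copy of a landed folklore lemma; filer edit,
`dedup.landed`). [folklore] -/
private theorem card_fermionTorus_two_eq : Fintype.card (FermionTorus 2 L) = L ^ 2 := by
  simp [FermionTorus, Fintype.card_lex]

omit [NeZero L] in
/-- `|Orb Λ_L| = 2L²` (file-private copy of a landed folklore lemma; filer edit,
`dedup.landed`). [folklore] -/
private theorem card_orb_fermionTorus_two_eq : Fintype.card (Orb (FermionTorus 2 L)) = 2 * L ^ 2 := by
  rw [Fintype.card_lex, Fintype.card_prod, Fintype.card_fin, card_fermionTorus_two_eq, mul_comm]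

/-- **THEOREM 13_N IN CLOSED ELEMENTARY FORM (bounds.tex §13, D5(d′)).** Under EXACTLY the
numeric hypotheses of #211.23 `norm_ttSectorZ_twist_sub_le_assembled` (`L ≥ 3`, `β > 0`, `U ≥ 0`;
arc/floor data; one-site Kotecký–Preiss smallness; off-arc fixed point with `offArcRateCeil`;
radii `0 < r < r₁ ≤ π/4`, `c₀ ≤ cos r₁`; window arithmetic `8√((1+4a/r²)|Λ_L|) + 2 ≤ K_w ≤ N`,
`N + K_w ≤ |Orb Λ_L|`):
`‖Z_N(θ) - Z_N(0)‖ ≤ (4/3)(4√((1+4a/r²)L²) + 1) · exp(2K_w (2βL²r♯ + 2K_w - 1)(1/(N - K_w + 1) +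
1/(2L² - N - K_w + 1))) · ((e^{2aL²e^{-δL}} - 1) + 2e^{-(e^{κ₋} + κ₋ - F - a)L²}) · Re Z_N(0)`,
`κ₋ = offArcRateFloor c₀ u₀ (N/L²) (2a/r)`, `r♯ = ttCommRateSharp t' U` — every quantity an
explicit elementary function. [programme: bounds.tex §13 Theorem 13_N, D5(d′); this file] -/
theorem norm_ttSectorZ_twist_sub_le_elementary (hL : 3 ≤ L) {β : ℝ} (hβ : 0 < β) {U : ℝ}
    (hU : 0 ≤ U) (t' θ : ℝ) {N Kw : ℕ} {c₀ u₀ R a δ F r r₁ : ℝ} (hc₀ : 0 ≤ c₀)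
    (hv : |β * U| ≤ u₀) (hR : 0 < R)
    (hfloor : 1 ≤ R ^ 2 * (1 - (1 - c₀) / 2 - (1 - c₀ ^ 2) / (1 + Real.exp (-(u₀ / 2))) ^ 2))
    (ha : 0 < a) (hδ : 0 < δ)
    (hsmall : 16 * (|β| * (1 + |t'|)) * Real.exp (2 * (|β| * (1 + |t'|))) *
      (R * Real.exp (a + δ) + a) ^ 2 ≤ a)
    (hF : Real.exp (offArcRateCeil c₀ u₀) +
      16 * (|β| * (1 + |t'|)) * Real.exp (2 * (|β| * (1 + |t'|))) * F ^ 2 ≤ F)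
    (hr : 0 < r) (hrr₁ : r < r₁) (hr₁ : r₁ ≤ Real.pi / 4) (hc₀r : c₀ ≤ Real.cos r₁)
    (hKw : 8 * Real.sqrt ((1 + 4 * a / r ^ 2) * Fintype.card (FermionTorus 2 L)) + 2 ≤ Kw)
    (hKwN : Kw ≤ N) (hNKw : N + Kw ≤ Fintype.card (Orb (FermionTorus 2 L))) :
    ‖ttSectorZ L β t' U θ N - ttSectorZ L β t' U 0 N‖ ≤
      4 / 3 * (4 * Real.sqrt ((1 + 4 * a / r ^ 2) * (L : ℝ) ^ 2) + 1) *
          Real.exp (2 * Kw * ((β * (2 * (L : ℝ) ^ 2 * ttCommRateSharp t' U) + (2 * Kw - 1)) *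
            (1 / ((N : ℝ) - Kw + 1) + 1 / (2 * (L : ℝ) ^ 2 - N - Kw + 1)))) *
        ((Real.exp (2 * a * (L : ℝ) ^ 2 * Real.exp (-(δ * L))) - 1) +
          2 * Real.exp (-((Real.exp (offArcRateFloor c₀ u₀ (N / (L : ℝ) ^ 2) (2 * a / r)) +
            offArcRateFloor c₀ u₀ (N / (L : ℝ) ^ 2) (2 * a / r) - F - a) * (L : ℝ) ^ 2))) *
        (ttSectorZ L β t' U 0 N).re := by
  have h := norm_ttSectorZ_twist_sub_le_assembled hL hβ hU t' θ hc₀ hv hR hfloor ha hδ hsmall hF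
    hr hrr₁ hr₁ hc₀r hKw hKwN hNKw
  -- the walk factor in elementary form
  have hKw1 : 1 ≤ Kw := by
    have h2 : (1 : ℝ) ≤ Kw := by
      linarith [Real.sqrt_nonneg ((1 + 4 * a / r ^ 2) * Fintype.card (FermionTorus 2 L))]
    exact_mod_cast h2
  have hC := transferWalkConstant_zero_pow_le_exp hKw1 hKwN hNKw
    (β * (Fintype.card (Orb (FermionTorus 2 L)) * ttCommRateSharp t' U))
  have hre : 0 ≤ (ttSectorZ L β t' U 0 N).re := (ttSectorZ_pos β t' U 0 (by omega)).1.le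
  have hP : 0 ≤ 4 / 3 *
      (4 * Real.sqrt ((1 + 4 * a / r ^ 2) * Fintype.card (FermionTorus 2 L)) + 1) := by
    positivity
  have hS : 0 ≤ (Real.exp (2 * a * (L : ℝ) ^ 2 * Real.exp (-(δ * L))) - 1) +
      2 * Real.exp (-((Real.exp (offArcRateFloor c₀ u₀
          (N / Fintype.card (FermionTorus 2 L)) (2 * a / r)) +
        offArcRateFloor c₀ u₀ (N / Fintype.card (FermionTorus 2 L)) (2 * a / r) - F - a) *
          Fintype.card (FermionTorus 2 L))) := by
    have h1 : 1 ≤ Real.exp (2 * a * (L : ℝ) ^ 2 * Real.exp (-(δ * L))) :=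
      Real.one_le_exp (by positivity)
    linarith [Real.exp_pos (-((Real.exp (offArcRateFloor c₀ u₀
          (N / Fintype.card (FermionTorus 2 L)) (2 * a / r)) +
        offArcRateFloor c₀ u₀ (N / Fintype.card (FermionTorus 2 L)) (2 * a / r) - F - a) *
          Fintype.card (FermionTorus 2 L)))]
  have h2 := h.trans (mul_le_mul_of_nonneg_right (mul_le_mul_of_nonneg_right
    (mul_le_mul_of_nonneg_left hC hP) hS) hre)
  -- the cardinalities
  have hΛ : (Fintype.card (FermionTorus 2 L) : ℝ) = (L : ℝ) ^ 2 := by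
    rw [card_fermionTorus_two_eq]; push_cast; ring
  have hn : (Fintype.card (Orb (FermionTorus 2 L)) : ℝ) = 2 * (L : ℝ) ^ 2 := by
    rw [card_orb_fermionTorus_two_eq]; push_cast; ring
  rw [hΛ, hn] at h2
  exact h2

end Torus

end Summit.HubbardSuperconductivity.HubbardLadder.Bounds
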